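import Summits.CriticalPhenomena.CardyFormulaZ2.Theorems.CardySusyWardParafermionFamiliesToSLESixHalfCRVertexRelation
import Literature.Probability.LatticeModels.DartFlux

/-!
# The half-CR pair identity at edges with an endpoint on the wired arc (stub `stub_halfCRLayer`, part 1)

Helper file for the crux `CardySusyWard.ParafermionFamiliesToSLESix` (stmt-CriticalPhenomena-10814),
line `strip-anchored-vertex-normalisation` (skeleton r4), registered sub-goal `stub_halfCRLayer` of
`stub_momentIdentity`: the half Cauchy–Riemann vertex relation of the spin-`1/3` corner observable
(Duminil-Copin 2012, Prop. 4 at `q = 1`; landed for INTERIOR medial vertices as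
`S2.halfCRVertexRelation_of_holeFree`) at every RANDOM both-faces-inner medial vertex, i.e. also on
the layer of lattice edges `e = {x, a}` from an interior site to a site `a` of the wired arc `A`.

The landed pathwise chain (`S2.loopTurn_eq`, `S2.gval_case1`, `S2.gval_add_gval_toggle`) asks that
ALL EIGHT faces at the two endpoints of `e` be inner (`hx`, `hy`), which fails at `a`.  Inspection
shows (as for the FK-Ising template, `DartFlux.lean`, Part 1) that these hypotheses are only used
(i) for the two faces OF `e` (the face of the arriving corner `p` and of its partner: the possible
faces of the dart after `p`, and the face through which the loop of the partner is recognised as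
off the interface), and (ii) to rule out that `p` is the exit corner, which already follows from `e`
having no endpoint on the arc `B`.  This file re-runs parts 1–2 under the weak hypotheses:

* `S2.loopTurn_eq_free`: the loop through the partner of the arriving corner turns by
  `4 · turnSign` (winding numbers of its coded trail, `MedialTrailUmlaufsatz`, hole-freeness);
* `S2.gval_case1_free`: the pair identity `g(β, N) + g(β', N + Q) = 0` when exactly `p` arrives,
  over the rearrangement `cornerOrbit_toggle_case1_free`.

Part 2 (`…HalfCRLayer.lean`) assembles the oddness of `g` under the flip and the relation.
-/

noncomputable section

namespace Summit.CriticalPhenomena.CardyFormulaZ2.Theorems.ParafermionFamiliesToSLESix.StripAnchored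

open Finset Complex
open Literature.Probability.Percolation (BondConfig vcell fcell cornerDart cornerDart_eq isDart_cornerDart
  cornerDart_injective lf_cornerDart rf_cornerDart)
open Literature.Probability.LatticeModels
open Literature.Probability.LatticeModels.MedialTrail (wnd lf rf IsDart IsTrail cdarts tube wnd_lf_eq_rf)

namespace S2

/-! ## Part 1′: orientation of the loop, weak hypotheses -/
section Loop

variable {β : BondConfig (Site 2)} {q : Site 2 × Fin 4} {Q : ℕ}

-- adapted from `S2.loopTurn_eq` (…HalfCRVertexRelationLoop.lean): `hx` weakened to the two faces of `cTgt q`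
/-- **Orientation of the loop through the partner of an arriving corner, weak hypotheses**
(`loopTurn_eq` with "all four faces at the vertex of `q` inner" replaced by "the two faces of the
edge `cTgt q` — the face of `q` and the next face `faceAt q.1 (q.2 + 1)` around its vertex — are
inner", the only two faces its proof visits: they are the possible faces of the dart after `q`).
For a configuration `β`, a start corner `c₀` of Dobrushin data with hole-free inner faces, a time
`N` at which the face is not inner, a corner `q = orb i₁` (`i₁ < N`) of the orbit of `c₀`, and the
cycle of minimal period `Q` of the turning rule through `cornerPartner q`, made of corners with
inner faces none of which is `orb i` (`i < N`): the turn signs around the cycle sum to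
`4 · turnSign β q`. [cite: Hopf1935, Satz I] -/
theorem loopTurn_eq_free {D : DiscreteDobrushin} (hH : HoleFree {f : Site 2 | D.IsInnerFace f})
    {c₀ : Site 2 × Fin 4} (hc₀ : D.IsStartCorner c₀)
    (hqf : D.IsInnerFace (cFace q)) (hqf' : D.IsInnerFace (faceAt q.1 (q.2 + 1)))
    {N i₁ : ℕ} (hN : ¬ D.IsInnerFace (cFace (cornerOrbit β c₀ N)))
    (hQ0 : 0 < Q) (hQ : cornerOrbit β (cornerPartner q) Q = cornerPartner q)
    (hQmin : ∀ s, 0 < s → s < Q → cornerOrbit β (cornerPartner q) s ≠ cornerPartner q)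
    (hLin : ∀ m, D.IsInnerFace (cFace (cornerOrbit β (cornerPartner q) m)))
    (hdisj : ∀ m i, i < N → cornerOrbit β (cornerPartner q) m ≠ cornerOrbit β c₀ i)
    (hi₁ : cornerOrbit β c₀ i₁ = q) (hi₁N : i₁ < N) :
    ∑ m ∈ Finset.range Q, turnSign β (cornerOrbit β (cornerPartner q) m) = 4 * turnSign β q := by
  classical
  set q₂ := cornerPartner q with hq₂
  have hT := isTrail_loopTrail hQ0 hQ hQmin
  have hl := hT.2.2
  -- the winding number along the path is that of the non-inner face across `e_a`, i.e. zero
  have h0 : ∀ m, cornerOrbit β q₂ m ≠ c₀ := fun m h => hdisj m 0 (by omega) h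
  have ha : wnd ((List.map (fun m => cpos (cornerOrbit β q₂ m)) (List.range Q))) (vcell c₀.1) = 0 := by
    rw [wnd_vcell_start_eq hc₀ hQ hl hLin h0]
    exact wnd_fcell_eq_zero_of_not_isInnerFace hH hQ0 hQ hQmin hLin hc₀.isOutEdge.2
  have halong := wnd_orbit_eq c₀ hQ hl hdisj
  -- the next dart of the path is still before the exit
  have hsucc : cornerOrbit β c₀ (i₁ + 1) = nextCorner β q := by rw [← hi₁]; rfl
  have hin1 : D.IsInnerFace (cFace (cornerOrbit β c₀ (i₁ + 1))) := by
    rw [hsucc]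
    by_cases he : cTgt q ∈ β
    · rw [cFace_nextCorner_of_mem he]; exact hqf
    · rw [cFace_nextCorner_of_not_mem he]; exact hqf'
  have hi₁N' : i₁ + 1 < N := lt_of_le_of_ne (by omega) fun h => hN (h ▸ hin1)
  obtain ⟨hv1, hf1⟩ := halong (i₁ + 1) hi₁N'
  rw [ha, hsucc] at hv1 hf1
  -- the dart of `q₂` is on the cycle; read off the type
  have hmem : cornerDart q₂ ∈ cdarts ((List.map (fun m => cpos (cornerOrbit β q₂ m)) (List.range Q))) :=
    cornerDart_mem_cdarts hQ0 hQ
  have hinv : (∑ m ∈ Finset.range Q, turnSign β (cornerOrbit β q₂ m) = 4 ∧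
      ∀ F, wnd ((List.map (fun m => cpos (cornerOrbit β q₂ m)) (List.range Q))) F = 0 ∨
        wnd ((List.map (fun m => cpos (cornerOrbit β q₂ m)) (List.range Q))) F = 1) ∨
      (∑ m ∈ Finset.range Q, turnSign β (cornerOrbit β q₂ m) = -4 ∧
      ∀ F, wnd ((List.map (fun m => cpos (cornerOrbit β q₂ m)) (List.range Q))) F = 0 ∨
        wnd ((List.map (fun m => cpos (cornerOrbit β q₂ m)) (List.range Q))) F = -1) :=
    inv_cornerOrbit hQ0 hQ hQmin
  have hjump := hT.wnd_lf hmem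
  rw [lf_cornerDart, rf_cornerDart] at hjump
  by_cases he : cTgt q ∈ β
  · -- open: the path follows `e` to the vertex of `q₂`, whose cell is LEFT of the dart of `q₂`
    rw [turnSign_of_mem he]
    rw [nextCorner_of_mem he] at hv1
    have hv : wnd ((List.map (fun m => cpos (cornerOrbit β q₂ m)) (List.range Q))) (vcell q₂.1) = 0 := hv1
    rcases hinv with ⟨_, hw⟩ | ⟨hs, -⟩
    · exfalso
      rcases hw (fcell (cFace q₂)) with h | h <;> omega
    · rw [hs]; norm_num
  · -- closed: the path crosses `e` into the face of `q₂`, whose cell is RIGHT of the dart of `q₂`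
    rw [turnSign_of_not_mem he]
    rw [cFace_nextCorner_of_not_mem he, ← cFace_cornerPartner] at hf1
    have hf : wnd ((List.map (fun m => cpos (cornerOrbit β q₂ m)) (List.range Q))) (fcell (cFace q₂)) = 0 :=
      hf1
    rcases hinv with ⟨hs, -⟩ | ⟨_, hw⟩
    · rw [hs]; norm_num
    · exfalso
      rcases hw (vcell q₂.1) with h | h <;> omega

end Loop

/-! ## Part 2′: the pair identity, case 1, weak hypotheses -/
section Case1

variable {D : DiscreteDobrushin} {ω ω' : BondConfig (Site 2)} {c₀ p : Site 2 × Fin 4}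

-- adapted from `S2.gval_case1` (…HalfCRVertexRelationPairing.lean): `hx`, `hy` weakened to the two faces of `e`
/-- **The pair identity, case 1, weak hypotheses** (`gval_case1` with "all faces at both endpoints
of `e` inner" replaced by "the two faces of `e = cTgt p` — of `p` and of its partner — are inner";
the far endpoint of `e` is off the arc `B` by `hB`).  `p = orb i₁` is a dart of the exploration of
`ω` but its partner `p₂` is not; the completions `β`, `β'` of `ω`, `ω'` agree off `e` and differ at
`e`; the loop `L` of `p₂` under `β` (minimal period `Q`) turns by `4 · turnSign β p`.  Then
`g(β, N) + g(β', N + Q) = 0`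
(the rearrangement is `cornerOrbit_toggle_case1_free` of `DartFlux.lean`; the dart bookkeeping and
the identity `λ² + iλ = 1` are those of `gval_case1`, verbatim).
[cite: DuminilCopin2012Parafermion, Proposition 4] [cite: DuminilCopinSmirnov2012Lattice, Proposition 8.6] -/
theorem gval_case1_free (hD : D.IsZdAdmissible) (hc₀ : D.IsStartCorner c₀)
    (hagree : ∀ e, e ≠ cTgt p → (e ∈ D.bcBondConfig ω' ↔ e ∈ D.bcBondConfig ω))
    (hdiff : ¬ (cTgt p ∈ D.bcBondConfig ω' ↔ cTgt p ∈ D.bcBondConfig ω))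
    (hB : ∀ x ∈ cTgt p, x ∉ D.zdArcB)
    (hpf : D.IsInnerFace (cFace p)) (hp₂f : D.IsInnerFace (cFace (cornerPartner p)))
    {N P Q i₁ : ℕ} (hN : ¬ D.IsInnerFace (cFace (cornerOrbit (D.bcBondConfig ω) c₀ N)))
    (hlt : ∀ k < N, D.IsInnerFace (cFace (cornerOrbit (D.bcBondConfig ω) c₀ k)))
    (hP0 : 0 < P) (hP : cornerOrbit (D.bcBondConfig ω) c₀ P = c₀)
    (hPmin : ∀ s, 0 < s → s < P → cornerOrbit (D.bcBondConfig ω) c₀ s ≠ c₀)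
    (hQ0 : 0 < Q) (hQ : cornerOrbit (D.bcBondConfig ω) (cornerPartner p) Q = cornerPartner p)
    (hQmin : ∀ s, 0 < s → s < Q → cornerOrbit (D.bcBondConfig ω) (cornerPartner p) s ≠ cornerPartner p)
    (hi₁ : cornerOrbit (D.bcBondConfig ω) c₀ i₁ = p) (hi₁N : i₁ < N)
    (h₂ : ∀ i < N, cornerOrbit (D.bcBondConfig ω) c₀ i ≠ cornerPartner p)
    (hS : ∑ m ∈ Finset.range Q, turnSign (D.bcBondConfig ω) (cornerOrbit (D.bcBondConfig ω) (cornerPartner p) m) =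
      4 * turnSign (D.bcBondConfig ω) p) :
    gval (D.bcBondConfig ω) c₀ p N + gval (D.bcBondConfig ω') c₀ p (N + Q) = 0 := by
  classical
  set p₂ := cornerPartner p with hp₂
  have hinj : ∀ a b, a < N → b < N →
      cornerOrbit (D.bcBondConfig ω) c₀ a = cornerOrbit (D.bcBondConfig ω) c₀ b → a = b := by
    intro a b ha hb h
    by_contra hne
    rcases Nat.lt_or_gt_of_ne hne with hab | hab
    · exact cornerOrbit_ne hD hc₀ hab (fun k hk => hlt k (by omega)) h
    · exact cornerOrbit_ne hD hc₀ hab (fun k hk => hlt k (by omega)) h.symm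
  -- the two faces of `e`, and its far endpoint (off the arc `B`)
  have hpf' : D.IsInnerFace (faceAt p.1 (p.2 + 1)) := by rw [← cFace_cornerPartner]; exact hp₂f
  have hpB : p.1 + cornerUnit (p.2 + 1) ∉ D.zdArcB := hB _ (Sym2.mem_mk_right _ _)
  -- the loop never meets the interface cycle (only the face of the partner is needed)
  have hdisj : ∀ m s, cornerOrbit (D.bcBondConfig ω) p₂ m ≠ cornerOrbit (D.bcBondConfig ω) c₀ s := by
    intro m s h
    obtain ⟨s', hs'⟩ := exists_eq_cornerOrbit_of_iterate hP0 hP m h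
    have hin : D.IsInnerFace (cFace (cornerOrbit (D.bcBondConfig ω) c₀ s')) := hs' ▸ hp₂f
    rw [isInnerFace_cornerOrbit_iff hD hc₀ hN hlt hP0 hP hPmin] at hin
    exact h₂ _ hin (by rw [cornerOrbit_mod_period hP]; exact hs'.symm)
  obtain ⟨hpre, hloop, htail, -, -⟩ := cornerOrbit_toggle_case1_free hD hc₀ hagree hdiff hpf hp₂f hpB hN hlt hP0 hP
    hPmin hQ0 hQ hQmin hi₁ hi₁N h₂
  have hB' : ∀ x ∈ cTgt p₂, x ∉ D.zdArcB := by rw [hp₂, cTgt_partner]; exact hB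
  -- ### the darts of `β = D.bcBondConfig ω` at `e`
  have hsucc : cornerOrbit (D.bcBondConfig ω) c₀ (i₁ + 1) = nextCorner (D.bcBondConfig ω) p := by rw [← hi₁]; rfl
  have hi₁N' : i₁ + 1 < N := by
    refine lt_of_le_of_ne (by omega) fun h => hN ?_
    rw [← h, hsucc]
    by_cases he : cTgt p ∈ (D.bcBondConfig ω)
    · rw [cFace_nextCorner_of_mem he]; exact hpf
    · rw [cFace_nextCorner_of_not_mem he]; exact hpf'
  have uP : ∀ j < N, cornerOrbit (D.bcBondConfig ω) c₀ j = p ↔ j = i₁ := fun j hj =>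
    ⟨fun h => hinj j i₁ hj hi₁N (h.trans hi₁.symm), fun h => h ▸ hi₁⟩
  have uS : ∀ j < N, cornerOrbit (D.bcBondConfig ω) c₀ j = nextCorner (D.bcBondConfig ω) p ↔ j = i₁ + 1 := by
    intro j hj
    refine ⟨fun h => ?_, fun h => h ▸ hsucc⟩
    obtain ⟨j', rfl, hj'⟩ := exists_pred_of_cSrc_eq hc₀ hB (by rw [h, cSrc_nextCorner])
    rcases hj' with hj' | hj'
    · rw [(uP j' (by omega)).1 hj']
    · exact absurd hj' (h₂ j' (by omega))
  have zS : ∀ j < N, cornerOrbit (D.bcBondConfig ω) c₀ j ≠ nextCorner (D.bcBondConfig ω) p₂ := by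
    intro j hj h
    obtain ⟨j', rfl, hj'⟩ := exists_pred_of_cSrc_eq hc₀ hB (by rw [h, cSrc_nextCorner, hp₂, cTgt_partner])
    rcases hj' with hj' | hj'
    · have : nextCorner (D.bcBondConfig ω) p = nextCorner (D.bcBondConfig ω) p₂ := by rw [← hj', ← h]; rfl
      exact partner_ne p (nextCorner_injective this).symm
    · exact h₂ j' (by omega) hj'
  -- ### the darts of `β' = D.bcBondConfig ω'` at `e` (exit time `N + Q`)
  have hloopQ : cornerOrbit (D.bcBondConfig ω') c₀ (i₁ + Q) = p₂ := by
    have := hloop (Q - 1) (by omega)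
    rwa [show i₁ + 1 + (Q - 1) = i₁ + Q by omega, Nat.sub_add_cancel hQ0, hQ] at this
  -- classification of the times `< N + Q`
  have hcls : ∀ j < N + Q, (j ≤ i₁ ∧ cornerOrbit (D.bcBondConfig ω') c₀ j = cornerOrbit (D.bcBondConfig ω) c₀ j) ∨
      (i₁ < j ∧ j ≤ i₁ + Q ∧ cornerOrbit (D.bcBondConfig ω') c₀ j = cornerOrbit (D.bcBondConfig ω) p₂ (j - i₁)) ∨
      (i₁ + Q < j ∧ cornerOrbit (D.bcBondConfig ω') c₀ j = cornerOrbit (D.bcBondConfig ω) c₀ (j - Q)) := by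
    intro j hj
    by_cases hj1 : j ≤ i₁
    · exact Or.inl ⟨hj1, hpre j hj1⟩
    · by_cases hj2 : j ≤ i₁ + Q
      · refine Or.inr (Or.inl ⟨by omega, hj2, ?_⟩)
        have := hloop (j - i₁ - 1) (by omega)
        rwa [show i₁ + 1 + (j - i₁ - 1) = j by omega, show j - i₁ - 1 + 1 = j - i₁ by omega] at this
      · refine Or.inr (Or.inr ⟨by omega, ?_⟩)
        have := htail (j - i₁ - Q - 1) (by omega)
        rwa [show i₁ + Q + 1 + (j - i₁ - Q - 1) = j by omega, show i₁ + 1 + (j - i₁ - Q - 1) = j - Q by omega] at this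
  have uP' : ∀ j < N + Q, cornerOrbit (D.bcBondConfig ω') c₀ j = p ↔ j = i₁ := by
    intro j hj
    refine ⟨fun h => ?_, fun h => by rw [h, hpre i₁ le_rfl, hi₁]⟩
    rcases hcls j hj with ⟨hj1, hoj⟩ | ⟨hj1, hj2, hoj⟩ | ⟨hj1, hoj⟩
    · exact (uP j (by omega)).1 (hoj ▸ h)
    · exact absurd ((hoj.symm.trans h).trans hi₁.symm) (hdisj _ _)
    · have := (uP (j - Q) (by omega)).1 (hoj ▸ h); omega
  have uP₂' : ∀ j < N + Q, cornerOrbit (D.bcBondConfig ω') c₀ j = p₂ ↔ j = i₁ + Q := by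
    intro j hj
    refine ⟨fun h => ?_, fun h => h ▸ hloopQ⟩
    rcases hcls j hj with ⟨hj1, hoj⟩ | ⟨hj1, hj2, hoj⟩ | ⟨hj1, hoj⟩
    · exact absurd (hoj ▸ h) (h₂ j (by omega))
    · by_contra hne
      exact hQmin (j - i₁) (by omega) (by omega) (hoj.symm.trans h)
    · exact absurd (hoj ▸ h) (h₂ (j - Q) (by omega))
  have hsucc' : cornerOrbit (D.bcBondConfig ω') c₀ (i₁ + 1) = nextCorner (D.bcBondConfig ω') p := by
    rw [← (uP' i₁ (by omega)).2 rfl]; rfl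
  have hsucc₂' : cornerOrbit (D.bcBondConfig ω') c₀ (i₁ + Q + 1) = nextCorner (D.bcBondConfig ω') p₂ := by
    rw [← hloopQ]; rfl
  have hnext' : nextCorner (D.bcBondConfig ω') p = nextCorner (D.bcBondConfig ω) p₂ := by
    rw [nextCorner_toggle hagree hdiff, Equiv.swap_apply_left]
  have hnext₂' : nextCorner (D.bcBondConfig ω') p₂ = nextCorner (D.bcBondConfig ω) p := by
    rw [nextCorner_toggle hagree hdiff, hp₂, Equiv.swap_apply_right]
  have uS' : ∀ j < N + Q, cornerOrbit (D.bcBondConfig ω') c₀ j = nextCorner (D.bcBondConfig ω') p ↔ j = i₁ + 1 := by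
    intro j hj
    refine ⟨fun h => ?_, fun h => h ▸ hsucc'⟩
    obtain ⟨j', rfl, hj'⟩ := exists_pred_of_cSrc_eq (ω := ω') hc₀ hB (by rw [h, cSrc_nextCorner])
    rcases hj' with hj' | hj'
    · rw [(uP' j' (by omega)).1 hj']
    · have hn : nextCorner (D.bcBondConfig ω') p₂ = nextCorner (D.bcBondConfig ω') p := by rw [hp₂, ← hj', ← h]; rfl
      exact absurd (nextCorner_injective hn) (partner_ne p)
  have uS₂' : ∀ j < N + Q,
      cornerOrbit (D.bcBondConfig ω') c₀ j = nextCorner (D.bcBondConfig ω') p₂ ↔ j = i₁ + Q + 1 := by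
    intro j hj
    refine ⟨fun h => ?_, fun h => h ▸ hsucc₂'⟩
    obtain ⟨j', rfl, hj'⟩ := exists_pred_of_cSrc_eq (ω := ω') hc₀ hB' (by rw [h, cSrc_nextCorner])
    rw [hp₂, partner_partner] at hj'
    rcases hj' with hj' | hj'
    · rw [(uP₂' j' (by omega)).1 hj']
    · have hn : nextCorner (D.bcBondConfig ω') p = nextCorner (D.bcBondConfig ω') p₂ := by rw [← hj', ← h]; rfl
      exact absurd (nextCorner_injective hn).symm (partner_ne p)
  -- ### turn counts
  set C := turnCount (D.bcBondConfig ω) c₀ i₁ with hC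
  have he'iff : cTgt p ∈ (D.bcBondConfig ω') ↔ cTgt p ∉ (D.bcBondConfig ω) := by
    constructor
    · exact fun h' h => hdiff ⟨fun _ => h, fun _ => h'⟩
    · intro h; by_contra h'; exact hdiff ⟨fun h'' => absurd h'' h', fun h'' => absurd h'' h⟩
  have htgt : ∀ j < N, j ≠ i₁ → cTgt (cornerOrbit (D.bcBondConfig ω) c₀ j) ≠ cTgt p := by
    intro j hj h1 h
    rcases cTgt_eq_cTgt_iff.1 h with h | h
    · exact h1 (hinj j i₁ hj hi₁N (h.trans hi₁.symm))
    · exact h₂ j hj h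
  have hC' : turnCount (D.bcBondConfig ω') c₀ i₁ = C :=
    turnCount_congr_prefix hpre fun j hj => hagree _ (htgt j (by omega) (by omega))
  have hLtgt : ∀ m, 0 < m → m < Q → cTgt (cornerOrbit (D.bcBondConfig ω) p₂ m) ≠ cTgt p := by
    intro m hm hmQ h
    rcases cTgt_eq_cTgt_iff.1 h with h | h
    · exact hdisj m i₁ (h.trans hi₁.symm)
    · exact hQmin m hm hmQ h
  have hS1 : ∑ m ∈ Finset.range (Q - 1), turnSign (D.bcBondConfig ω) (cornerOrbit (D.bcBondConfig ω) p₂ (m + 1)) =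
      3 * turnSign (D.bcBondConfig ω) p := by
    have h := hS
    rw [show Q = (Q - 1) + 1 by omega, Finset.sum_range_succ'] at h
    have h0 : turnSign (D.bcBondConfig ω) (cornerOrbit (D.bcBondConfig ω) p₂ 0) = turnSign (D.bcBondConfig ω) p :=
      turnSign_partner (D.bcBondConfig ω) p
    rw [h0] at h
    linear_combination h
  have hCQ' : turnCount (D.bcBondConfig ω') c₀ (i₁ + Q) =
      C + turnSign (D.bcBondConfig ω') p + 3 * turnSign (D.bcBondConfig ω) p := by
    rw [turnCount_add, show Q = (Q - 1) + 1 by omega, Finset.sum_range_succ', add_zero,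
      hpre i₁ le_rfl, hi₁, hC', ← hS1]
    have hterm : ∀ m ∈ Finset.range (Q - 1), turnSign (D.bcBondConfig ω') (cornerOrbit (D.bcBondConfig ω') c₀ (i₁ + (m + 1))) =
        turnSign (D.bcBondConfig ω) (cornerOrbit (D.bcBondConfig ω) p₂ (m + 1)) := by
      intro m hm
      rw [Finset.mem_range] at hm
      rw [show i₁ + (m + 1) = i₁ + 1 + m by omega, hloop m (by omega)]
      exact turnSign_congr (hagree _ (hLtgt (m + 1) (Nat.succ_pos _) (by omega)))
    rw [Finset.sum_congr rfl hterm]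
    ring
  have hCs : turnCount (D.bcBondConfig ω) c₀ (i₁ + 1) = C + turnSign (D.bcBondConfig ω) p := by
    rw [turnCount_succ, hi₁]
  have hCs' : turnCount (D.bcBondConfig ω') c₀ (i₁ + 1) = C + turnSign (D.bcBondConfig ω') p := by
    rw [turnCount_succ, hpre i₁ le_rfl, hi₁, hC']
  have hCQs' : turnCount (D.bcBondConfig ω') c₀ (i₁ + Q + 1) =
      C + turnSign (D.bcBondConfig ω') p + 3 * turnSign (D.bcBondConfig ω) p + turnSign (D.bcBondConfig ω') p := by
    rw [turnCount_succ, hloopQ, hCQ', turnSign_partner]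
  -- ### the weights
  have wP : dartW (D.bcBondConfig ω) c₀ p N = sixthPhase C := dartW_eq_single hi₁N uP
  have wP₂ : dartW (D.bcBondConfig ω) c₀ p₂ N = 0 := dartW_eq_zero h₂
  have wS : dartW (D.bcBondConfig ω) c₀ (nextCorner (D.bcBondConfig ω) p) N =
      sixthPhase (C + turnSign (D.bcBondConfig ω) p) := by
    rw [dartW_eq_single hi₁N' uS, hCs]
  have wS₂ : dartW (D.bcBondConfig ω) c₀ (nextCorner (D.bcBondConfig ω) p₂) N = 0 := dartW_eq_zero zS
  have wP' : dartW (D.bcBondConfig ω') c₀ p (N + Q) = sixthPhase C := by rw [dartW_eq_single (by omega) uP', hC']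
  have wP₂' : dartW (D.bcBondConfig ω') c₀ p₂ (N + Q) =
      sixthPhase (C + turnSign (D.bcBondConfig ω') p + 3 * turnSign (D.bcBondConfig ω) p) := by
    rw [dartW_eq_single (by omega) uP₂', hCQ']
  have wS' : dartW (D.bcBondConfig ω') c₀ (nextCorner (D.bcBondConfig ω) p₂) (N + Q) =
      sixthPhase (C + turnSign (D.bcBondConfig ω') p) := by
    rw [← hnext', dartW_eq_single (by omega) uS', hCs']
  have wS₂' : dartW (D.bcBondConfig ω') c₀ (nextCorner (D.bcBondConfig ω) p) (N + Q) =
      sixthPhase (C + turnSign (D.bcBondConfig ω') p + 3 * turnSign (D.bcBondConfig ω) p + turnSign (D.bcBondConfig ω') p) := by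
    rw [← hnext₂', dartW_eq_single (by omega) uS₂', hCQs']
  -- ### the algebra, in the two cases `e` closed / open in `β`
  have key := sixthPhase_one_sub; have key1 := sixthPhase_one_mul_neg_one
  by_cases he : cTgt p ∈ (D.bcBondConfig ω)
  · -- `e` open in `β`: `p` is followed, `s = -1`
    have he' : cTgt p ∉ (D.bcBondConfig ω') := fun h => (he'iff.1 h) he
    have hs : turnSign (D.bcBondConfig ω) p = -1 := turnSign_of_mem he
    have hs' : turnSign (D.bcBondConfig ω') p = 1 := turnSign_of_not_mem he'
    have n1 : nextCorner (D.bcBondConfig ω) p = (p₂.1, p₂.2 + 1) := by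
      rw [nextCorner_of_mem he, hp₂, cornerPartner]; simp only; rw [fin4_add_two_add_one]
    have n2 : nextCorner (D.bcBondConfig ω) p₂ = (p.1, p.2 + 1) := nextCorner_partner_of_mem he
    rw [hs] at wS
    rw [hs, hs'] at wP₂' wS₂'
    rw [hs'] at wS'
    unfold gval
    rw [← hp₂, ← n1, ← n2, wP, wP₂, wS, wS₂, wP', wP₂', wS', wS₂']
    have e1 : sixthPhase (C + -1) = sixthPhase C * sixthPhase (-1) := sixthPhase_add _ _
    have e2 : sixthPhase (C + 1) = sixthPhase C * sixthPhase 1 := sixthPhase_add _ _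
    have e3 : sixthPhase (C + 1 + 3 * -1) = sixthPhase C * (sixthPhase (-1) * sixthPhase (-1)) := by
      rw [← sixthPhase_add, ← sixthPhase_add]; congr 1; ring
    have e4 : sixthPhase (C + 1 + 3 * -1 + 1) = sixthPhase C * sixthPhase (-1) := by
      rw [← sixthPhase_add]; congr 1; ring
    rw [e1, e2, e3, e4]
    linear_combination (sixthPhase C * (1 + I * sixthPhase (-1))) * key + (-(sixthPhase C * I)) * key1 +
      (-(sixthPhase C * sixthPhase (-1))) * Complex.I_mul_I
  · -- `e` closed in `β`: `p` crosses, `s = +1`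
    have he' : cTgt p ∈ (D.bcBondConfig ω') := he'iff.2 he
    have hs : turnSign (D.bcBondConfig ω) p = 1 := turnSign_of_not_mem he
    have hs' : turnSign (D.bcBondConfig ω') p = -1 := turnSign_of_mem he'
    have n1 : nextCorner (D.bcBondConfig ω) p = (p.1, p.2 + 1) := nextCorner_of_not_mem he
    have n2 : nextCorner (D.bcBondConfig ω) p₂ = (p₂.1, p₂.2 + 1) := by
      rw [hp₂, nextCorner_partner_of_not_mem he, cornerPartner]; simp only; rw [fin4_add_two_add_one]
    rw [hs] at wS
    rw [hs, hs'] at wP₂' wS₂'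
    rw [hs'] at wS'
    unfold gval
    rw [← hp₂, ← n1, ← n2, wP, wP₂, wS, wS₂, wP', wP₂', wS', wS₂']
    have e1 : sixthPhase (C + -1) = sixthPhase C * sixthPhase (-1) := sixthPhase_add _ _
    have e2 : sixthPhase (C + 1) = sixthPhase C * sixthPhase 1 := sixthPhase_add _ _
    have e3 : sixthPhase (C + -1 + 3 * 1) = sixthPhase C * (sixthPhase 1 * sixthPhase 1) := by
      rw [← sixthPhase_add, ← sixthPhase_add]; congr 1; ring
    have e4 : sixthPhase (C + -1 + 3 * 1 + -1) = sixthPhase C * sixthPhase 1 := by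
      rw [← sixthPhase_add]; congr 1; ring
    rw [e1, e2, e3, e4]
    linear_combination (sixthPhase C * (1 - I * sixthPhase 1)) * key + (-(sixthPhase C * I)) * key1 +
      (sixthPhase C * sixthPhase 1) * Complex.I_mul_I

end Case1

end S2

/-- **Registered one-line form of the pair identity under the weak hypotheses** `S2.gval_case1_free`
(sub-goal `stub_halfCRLayer_pairing` of stmt-CriticalPhenomena-10814, part 1 of stub `stub_halfCRLayer`).
[cite: DuminilCopin2012Parafermion, Proposition 4] -/
theorem stub_halfCRLayer_pairing : ∀ (D : DiscreteDobrushin) (ω ω' : BondConfig (Site 2)) (c₀ p : Site 2 × Fin 4) (N P Q i₁ : ℕ), D.IsZdAdmissible → D.IsStartCorner c₀ → (∀ e, e ≠ cTgt p → (e ∈ D.bcBondConfig ω' ↔ e ∈ D.bcBondConfig ω)) → ¬ (cTgt p ∈ D.bcBondConfig ω' ↔ cTgt p ∈ D.bcBondConfig ω) → (∀ x ∈ cTgt p, x ∉ D.zdArcB) → D.IsInnerFace (cFace p) → D.IsInnerFace (cFace (cornerPartner p)) → ¬ D.IsInnerFace (cFace (cornerOrbit (D.bcBondConfig ω) c₀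 N)) → (∀ k < N, D.IsInnerFace (cFace (cornerOrbit (D.bcBondConfig ω) c₀ k))) → 0 < P → cornerOrbit (D.bcBondConfig ω) c₀ P = c₀ → (∀ s, 0 < s → s < P → cornerOrbit (D.bcBondConfig ω) c₀ s ≠ c₀) → 0 < Q → cornerOrbit (D.bcBondConfig ω) (cornerPartner p) Q = cornerPartner p → (∀ s, 0 < s → s < Q → cornerOrbit (D.bcBondConfig ω) (cornerPartner p) s ≠ cornerPartner p) → cornerOrbit (D.bcBondConfig ω) c₀ i₁ = p → i₁ < N → (∀ i < N, cornerOrbit (D.bcBondConfig ω) c₀ i ≠ cornerPartner p) → ∑ m ∈ Finset.range Q, turnSign (D.bcBondConfig ω) (cornerOrbit (D.bcBondConfig ω) (cornerPartner p) m) = 4 * turnSign (D.bcBondConfig ω) p → S2.gval (D.bcBondConfig ω) c₀ p N + S2.gval (D.bcBondConfig ω') c₀ p (N + Q) = 0 :=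
  fun _ _ _ _ _ _ _ _ _ hD hc₀ hagree hdiff hB hpf hp₂f hN hlt hP0 hP hPmin hQ0 hQ hQmin hi₁ hi₁N h₂ hS =>
    S2.gval_case1_free hD hc₀ hagree hdiff hB hpf hp₂f hN hlt hP0 hP hPmin hQ0 hQ hQmin hi₁ hi₁N h₂ hS

end Summit.CriticalPhenomena.CardyFormulaZ2.Theorems.ParafermionFamiliesToSLESix.StripAnchored

end
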